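import Summits.QuantumFields.QCD.Theorems.RayDescent.Negative.CornerPinLoadBearing

/-!
# Crux `RayDescent` (stmt-QuantumFields-16900), negative side — the pin tolerance is sharp and
one-sided; stub (B) `stub_repinInvariance` needs `o(a/Z_m)`, not `O(a/Z_m)`

Disprover record (route `EulerDescent`, sub-problem QCD; cdisprove seat, cycle 1), sharpening
`CornerPinLoadBearing.lean` (p167133) from DELETION of the pin to its TOLERANCE:

* `rayDescent_false_with_negative_pin_offset` — replace the crux's pin `(m_crit − mc)·Z_m/a → 0`
  by a pin AT A FIXED OFFSET `c < 0` BELOW the intrinsic corner, `(m_crit − mc)·Z_m/a → c`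
  (everything else verbatim). For EVERY `c < 0` the resulting statement is false, given one honestly
  pinned regularisation of the standard picture (corner `mc` with pin `→ 0`, mass and asymptotic
  scaling, `m_crit → 0`, `a/Z_m → 0`, one gapped degenerate tuple `μ₀` at rate `Δ₀`, and below `μ₀`
  soft degenerate tuples at every rate). Witness: shift `m_crit ↦ m_crit − a|c|/Z_m` (pin offset
  exactly `c`), base tuple `μ₁ + |c|` with `μ₁ < μ₀` soft at rate `ε₀ = Δ₀|c|/(2(μ₀+|c|))`, scale
  `l = (μ₀ + |c|)/(μ₁ + |c|) ≥ 1`: the tuple `l·m` is the gapped tuple `μ₀` of `reg`, the tuple `m`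
  is the soft tuple `μ₁`, and `ε₀ < Δ₀/l`. So the pin tolerance `o(a/Z_m)` of the crux cannot be
  relaxed to ANY fixed negative multiple of `a/Z_m`. (For `c > 0` — critical mass ABOVE the corner —
  the shifted statement is the crux for heavier true masses and is NOT refutable this way: the pin
  is one-sided in substance, cf. census D1.)
* `repinInvariance_false_with_bounded_pin` — the line's stub (B) (`stub_repinInvariance`, skeleton
  77369e41…, statement quoted verbatim in tree vocabulary) with its pin hypothesis relaxed from
  `→ 0` to EVENTUALLY BOUNDED (`∃ C, ∀ᶠ k, |(m_crit − mc)·Z_m/a| ≤ C`) is false, given a regularisation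
  whose critical mass IS the corner, with mass and asymptotic scaling, `m_crit → 0`, `a/Z_m → 0`, a
  gapped degenerate tuple `μ₀` (rate `Δ₀`) and a soft one `μ₁ < μ₀` (rate `Δ₀/2`): re-pin by the
  bounded offset `μ₀ − μ₁` and the gapped tuple `μ₀` of `reg` becomes the soft tuple `μ₁`. Any proof
  of (B) must use `e_k → 0`, not `sup_k |e_k| < ∞`.

Witness data are hypotheses (standard `N_f = 2, 3` picture; not constructible here). Def-free. [folklore]
-/

noncomputable section

open Filter Topology
open Literature.MathematicalPhysics.QuantumFieldTheory

namespace Summit.QuantumFields.QCD.Theorems.RayDescentNegative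

/-- The pin ratio of the shifted critical mass `g = m_crit − a M/Z_m` against any `mc` is the old
ratio minus `M`. [folklore] -/
theorem pin_ratio_shift {Nf : ℕ} (reg : QCDRegularisation Nf) (mc : ℕ → ℝ) (M : ℝ) (k : ℕ) :
    (reg.mcrit k - reg.a k * M / reg.Zm k - mc k) * reg.Zm k / reg.a k =
      (reg.mcrit k - mc k) * reg.Zm k / reg.a k - M := by
  have ha : reg.a k ≠ 0 := (reg.a_pos k).ne'
  have hZ : reg.Zm k ≠ 0 := (reg.Zm_pos k).ne'
  field_simp
  ring

/-- **The pin tolerance is sharp (one-sided): every fixed NEGATIVE offset kills the crux.** For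
every `c < 0`, `RayDescent` with its pin hypothesis replaced by `(m_crit − mc)·Z_m/a → c` (corner,
mass scaling, asymptotic scaling, Lüscher branch verbatim) is false, given one honestly pinned
regularisation of the standard picture (hypotheses; not constructed here). [folklore] -/
theorem rayDescent_false_with_negative_pin_offset
    {Nf : ℕ} (reg : QCDRegularisation Nf) (mc : ℕ → ℝ)
    (hcorner : ∀ᶠ k in atTop, IsLUB {μ : ℝ | ¬ (∀ (R R' : ℕ) (A : QCDLatticeObservable Nf R)
        (B : QCDLatticeObservable Nf R'), ∃ (C δ : ℝ) (S₀ : ℕ), 0 < δ ∧ ∀ S : ℕ, S₀ ≤ S →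
          ∀ n : ℕ, n ≤ S → ‖qcdLatticeConnectedCorr (reg.β k) (2 * S + 1) (fun _ : Fin Nf => μ)
            A B n‖ ≤ C * Real.exp (-(δ * n)))} (mc k))
    (hpin : Tendsto (fun k => (reg.mcrit k - mc k) * reg.Zm k / reg.a k) atTop (𝓝 0))
    (hms : reg.HasMassScaling) (haf : (reg.scheme 0 0 0).HasAsymptoticScaling)
    (hcrit : Tendsto reg.mcrit atTop (𝓝 0))
    (hres : Tendsto (fun k => reg.a k / reg.Zm k) atTop (𝓝 0))
    {μ₀ Δ₀ : ℝ} (hμ₀ : 0 < μ₀) (hΔ₀ : 0 < Δ₀)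
    (hgap : (reg.scheme (fun _ : Fin Nf => μ₀) 0 0).HasLatticeMassGap Δ₀)
    (hsoft : ∀ ε : ℝ, 0 < ε → ∃ μ : ℝ, 0 < μ ∧ μ < μ₀ ∧
      ¬ (reg.scheme (fun _ : Fin Nf => μ) 0 0).HasLatticeMassGap ε)
    (c : ℝ) (hc : c < 0) :
    ¬ (∀ (Nf : ℕ) (reg : QCDRegularisation Nf) (mc : ℕ → ℝ),
        (∀ᶠ k in atTop, IsLUB {μ : ℝ | ¬ (∀ (R R' : ℕ) (A : QCDLatticeObservable Nf R)
            (B : QCDLatticeObservable Nf R'), ∃ (C δ : ℝ) (S₀ : ℕ), 0 < δ ∧ ∀ S : ℕ, S₀ ≤ S →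
              ∀ n : ℕ, n ≤ S → ‖qcdLatticeConnectedCorr (reg.β k) (2 * S + 1)
                (fun _ : Fin Nf => μ) A B n‖ ≤ C * Real.exp (-(δ * n)))} (mc k)) →
        Tendsto (fun k => (reg.mcrit k - mc k) * reg.Zm k / reg.a k) atTop (𝓝 c) →
        reg.HasMassScaling → (reg.scheme 0 0 0).HasAsymptoticScaling →
        (∀ᶠ k in atTop, (-1 : ℝ) < reg.mcrit k) →
        ∀ m : Fin Nf → ℝ, (∀ f, 0 < m f) → ∀ l : ℝ, 1 ≤ l → ∀ Δ : ℝ, 0 < Δ →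
          (reg.scheme (fun f => l * m f) 0 0).HasLatticeMassGap Δ →
          ∀ Δ' : ℝ, 0 < Δ' → Δ' < Δ / l → (reg.scheme m 0 0).HasLatticeMassGap Δ') := by
  intro hD
  -- the offset `M₀ = |c| > 0`, the soft rate `ε₀ = Δ₀ M₀ / (2 (μ₀ + M₀))`, a soft point `μ₁ < μ₀`
  set M₀ : ℝ := -c with hM₀
  have hM₀pos : 0 < M₀ := by rw [hM₀]; linarith
  have hsum₀ : 0 < μ₀ + M₀ := by linarith
  set ε₀ : ℝ := Δ₀ * M₀ / (2 * (μ₀ + M₀)) with hε₀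
  have hε₀pos : 0 < ε₀ := by rw [hε₀]; positivity
  obtain ⟨μ₁, hμ₁, hμ₁lt, hnogap⟩ := hsoft ε₀ hε₀pos
  have hsum₁ : 0 < μ₁ + M₀ := by linarith
  -- the shifted critical mass (opaque) and the re-pinned regularisation
  obtain ⟨g, hg⟩ : ∃ g : ℕ → ℝ, ∀ k, g k = reg.mcrit k - reg.a k * M₀ / reg.Zm k :=
    ⟨_, fun _ => rfl⟩
  have hcorner₁ : ∀ᶠ k in atTop, IsLUB {μ : ℝ | ¬ (∀ (R R' : ℕ) (A : QCDLatticeObservable Nf R)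
      (B : QCDLatticeObservable Nf R'), ∃ (C δ : ℝ) (S₀ : ℕ), 0 < δ ∧ ∀ S : ℕ, S₀ ≤ S →
        ∀ n : ℕ, n ≤ S → ‖qcdLatticeConnectedCorr
          (({ reg with mcrit := g } : QCDRegularisation Nf).β k) (2 * S + 1)
            (fun _ : Fin Nf => μ) A B n‖ ≤ C * Real.exp (-(δ * n)))} (mc k) := hcorner
  have hpin₁ : Tendsto (fun k => (({ reg with mcrit := g } : QCDRegularisation Nf).mcrit k - mc k) *
      ({ reg with mcrit := g } : QCDRegularisation Nf).Zm k /
        ({ reg with mcrit := g } : QCDRegularisation Nf).a k) atTop (𝓝 c) := by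
    have h := hpin.sub_const M₀
    rw [zero_sub, hM₀, neg_neg] at h
    refine h.congr' (Eventually.of_forall fun k => ?_)
    show (reg.mcrit k - mc k) * reg.Zm k / reg.a k - -c = (g k - mc k) * reg.Zm k / reg.a k
    rw [hg k, pin_ratio_shift, hM₀]
  have hms₁ : ({ reg with mcrit := g } : QCDRegularisation Nf).HasMassScaling := hms
  have haf₁ :
      (({ reg with mcrit := g } : QCDRegularisation Nf).scheme 0 0 0).HasAsymptoticScaling := haf
  have hbranch₁ : ∀ᶠ k in atTop,
      (-1 : ℝ) < ({ reg with mcrit := g } : QCDRegularisation Nf).mcrit k := by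
    filter_upwards [eventually_branch_shift reg hcrit hres M₀] with k hk
    show (-1 : ℝ) < g k
    rw [hg k]
    exact hk
  -- base tuple `μ₁ + M₀`, scale `l = (μ₀ + M₀)/(μ₁ + M₀)`
  set l : ℝ := (μ₀ + M₀) / (μ₁ + M₀) with hl
  have hl1 : 1 ≤ l := by
    rw [hl, le_div_iff₀ hsum₁, one_mul]
    linarith
  have hlm : l * (μ₁ + M₀) = μ₀ + M₀ := by
    rw [hl]
    field_simp
  have hmpos : ∀ _f : Fin Nf, (0 : ℝ) < μ₁ + M₀ := fun _ => hsum₁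
  have hup : (({ reg with mcrit := g } : QCDRegularisation Nf).scheme
      (fun f : Fin Nf => l * (fun _ : Fin Nf => μ₁ + M₀) f) 0 0).HasLatticeMassGap Δ₀ := by
    refine hasLatticeMassGap_repin_of_mq_eq reg g (fun _ => μ₀) _ (fun f k => ?_) hgap
    show reg.mcrit k + reg.a k * μ₀ / reg.Zm k = g k + reg.a k * (l * (μ₁ + M₀)) / reg.Zm k
    rw [hlm, hg k]
    ring
  have hε₀lt : ε₀ < Δ₀ / l := by
    have e : Δ₀ / l = Δ₀ * (μ₁ + M₀) / (μ₀ + M₀) := by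
      rw [hl]
      field_simp
    rw [e, hε₀, div_lt_div_iff₀ (by positivity) hsum₀]
    have h1 : 0 < Δ₀ * (μ₀ + M₀) := by positivity
    nlinarith
  have hdown := hD Nf ({ reg with mcrit := g } : QCDRegularisation Nf) mc hcorner₁ hpin₁ hms₁ haf₁
    hbranch₁ (fun _ => μ₁ + M₀) hmpos l hl1 Δ₀ hΔ₀ hup ε₀ hε₀pos hε₀lt
  refine hnogap (hasLatticeMassGap_of_repin_of_mq_eq reg g (fun _ => μ₁) (fun _ => μ₁ + M₀)
    (fun f k => ?_) hdown)
  rw [hg k]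
  ring

/-- **Stub (B) needs the pin to tend to zero: a bounded pin is not enough.** The statement of
`stub_repinInvariance` (line `Sketch`; birth's stub (B)) with its hypothesis
`(m_crit − mc)·Z_m/a → 0` relaxed to `∃ C, ∀ᶠ k, |(m_crit − mc)·Z_m/a| ≤ C` is false, given one
regularisation whose critical mass IS eventually the intrinsic corner, with mass and asymptotic
scaling, `m_crit → 0`, `a/Z_m → 0`, a gapped degenerate tuple `μ₀` at rate `Δ₀` and a soft one
`μ₁ < μ₀` at rate `Δ₀/2` (hypotheses; not constructed here): re-pin by the constant offset
`μ₀ − μ₁`. [folklore] -/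
theorem repinInvariance_false_with_bounded_pin
    {Nf : ℕ} (reg : QCDRegularisation Nf)
    (hcorner : ∀ᶠ k in atTop, IsLUB {μ : ℝ | ¬ (∀ (R R' : ℕ) (A : QCDLatticeObservable Nf R)
        (B : QCDLatticeObservable Nf R'), ∃ (C δ : ℝ) (S₀ : ℕ), 0 < δ ∧ ∀ S : ℕ, S₀ ≤ S →
          ∀ n : ℕ, n ≤ S → ‖qcdLatticeConnectedCorr (reg.β k) (2 * S + 1) (fun _ : Fin Nf => μ)
            A B n‖ ≤ C * Real.exp (-(δ * n)))} (reg.mcrit k))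
    (hms : reg.HasMassScaling) (haf : (reg.scheme 0 0 0).HasAsymptoticScaling)
    (hcrit : Tendsto reg.mcrit atTop (𝓝 0))
    (hres : Tendsto (fun k => reg.a k / reg.Zm k) atTop (𝓝 0))
    {μ₀ μ₁ Δ₀ : ℝ} (hμ₁ : 0 < μ₁) (hμ₁₀ : μ₁ < μ₀) (hΔ₀ : 0 < Δ₀)
    (hgap : (reg.scheme (fun _ : Fin Nf => μ₀) 0 0).HasLatticeMassGap Δ₀)
    (hnogap : ¬ (reg.scheme (fun _ : Fin Nf => μ₁) 0 0).HasLatticeMassGap (Δ₀ / 2)) :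
    ¬ (∀ (Nf : ℕ) (reg : QCDRegularisation Nf) (mc : ℕ → ℝ),
      ((∀ᶠ k in atTop, IsLUB {μ : ℝ | ¬ (∀ (R R' : ℕ) (A : QCDLatticeObservable Nf R)
          (B : QCDLatticeObservable Nf R'), ∃ (C δ : ℝ) (S₀ : ℕ), 0 < δ ∧ ∀ S : ℕ, S₀ ≤ S →
            ∀ n : ℕ, n ≤ S → ‖qcdLatticeConnectedCorr (reg.β k) (2 * S + 1) (fun _ : Fin Nf => μ)
              A B n‖ ≤ C * Real.exp (-(δ * n)))} (reg.mcrit k)) ∨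
        (∀ᶠ k in atTop, IsLUB {μ : ℝ | ¬ (∀ (R R' : ℕ) (A : QCDLatticeObservable Nf R)
          (B : QCDLatticeObservable Nf R'), ∃ (C δ : ℝ) (S₀ : ℕ), 0 < δ ∧ ∀ S : ℕ, S₀ ≤ S →
            ∀ n : ℕ, n ≤ S → ‖qcdLatticeConnectedCorr (reg.β k) (2 * S + 1) (fun _ : Fin Nf => μ)
              A B n‖ ≤ C * Real.exp (-(δ * n)))} (mc k))) →
      (∃ C : ℝ, ∀ᶠ k in atTop, |(reg.mcrit k - mc k) * reg.Zm k / reg.a k| ≤ C) →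
      reg.HasMassScaling → (reg.scheme 0 0 0).HasAsymptoticScaling →
      ∀ m : Fin Nf → ℝ, (∀ f, 0 < m f) →
        (∀ᶠ k in atTop, ∀ f, (-1 : ℝ) < reg.mcrit k + reg.a k * m f / reg.Zm k ∧
          (-1 : ℝ) < mc k + reg.a k * m f / reg.Zm k) →
        ∀ Δ : ℝ, 0 < Δ → (reg.scheme m 0 0).HasLatticeMassGap Δ →
          ∀ Δ' : ℝ, 0 < Δ' → Δ' < Δ →
            (({ reg with mcrit := mc } : QCDRegularisation Nf).scheme m 0 0).HasLatticeMassGap Δ') := by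
  intro hB
  have hμ₀ : 0 < μ₀ := hμ₁.trans hμ₁₀
  -- re-pin by the constant offset `M₀ = μ₀ − μ₁ > 0`
  obtain ⟨g, hg⟩ : ∃ g : ℕ → ℝ, ∀ k, g k = reg.mcrit k - reg.a k * (μ₀ - μ₁) / reg.Zm k :=
    ⟨_, fun _ => rfl⟩
  have hbdd : ∃ C : ℝ, ∀ᶠ k in atTop, |(reg.mcrit k - g k) * reg.Zm k / reg.a k| ≤ C := by
    refine ⟨|μ₀ - μ₁|, Eventually.of_forall fun k => ?_⟩
    have ha : reg.a k ≠ 0 := (reg.a_pos k).ne'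
    have hZ : reg.Zm k ≠ 0 := (reg.Zm_pos k).ne'
    have e : (reg.mcrit k - g k) * reg.Zm k / reg.a k = μ₀ - μ₁ := by
      rw [hg k]
      field_simp
      ring
    rw [e]
  have hrange : ∀ᶠ k in atTop, ∀ _f : Fin Nf, (-1 : ℝ) < reg.mcrit k + reg.a k * μ₀ / reg.Zm k ∧
      (-1 : ℝ) < g k + reg.a k * μ₀ / reg.Zm k := by
    filter_upwards [eventually_branch_shift reg hcrit hres (-μ₀),
      eventually_branch_shift reg hcrit hres (-μ₁)] with k h0 h1 _f
    constructor
    · have e : reg.mcrit k + reg.a k * μ₀ / reg.Zm k = reg.mcrit k - reg.a k * -μ₀ / reg.Zm k := by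
        ring
      rw [e]; exact h0
    · have e : g k + reg.a k * μ₀ / reg.Zm k = reg.mcrit k - reg.a k * -μ₁ / reg.Zm k := by
        rw [hg k]; ring
      rw [e]; exact h1
  have h := hB Nf reg g (Or.inl hcorner) hbdd hms haf (fun _ => μ₀) (fun _ => hμ₀) hrange Δ₀ hΔ₀
    hgap (Δ₀ / 2) (by positivity) (by linarith)
  refine hnogap (hasLatticeMassGap_of_repin_of_mq_eq reg g (fun _ => μ₁) (fun _ => μ₀)
    (fun f k => ?_) h)
  rw [hg k]
  ring

end Summit.QuantumFields.QCD.Theorems.RayDescentNegative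

end
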